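/-
Copyright (c) 2026 the pub-hodgecm-mathlib formalisation cell (harness21).  Prover seat hodgecm-mathlib-K2Liu-p01 (g6), Track B «K2-LIT»,
Road I organ (A-int)-fin, A2d «geometric actions junction», second file (LEAD F0P6-plan (g12) 08:00:40Z).  KERNEL: theorems only.
-/
import Summits.HodgeConjecture.HodgeConjecture.Theorems.K2LiuDeltaSpTransportSiegelLetters   -- ★ A2d file 1 (letters (P)(N) in `ℓ_Δ`-coordinates; brings A2c, β-1, β-3)
import HarnessLib

/-!
# Crux `HLiu418`, Track B road `K2_Liu`, Road I organ (A-int)-fin — A2d (file 2): THE JUNCTION OF THE SIEGEL LETTERS WITH THE WEIL OPERATORS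
# in (β-1)'s doubling-polarised model (`toRep (sΔ h) = c • (leviEquivSB a ∘ unipotentEquivSB q_b)` on `P_Δ`; `= c • unipotentEquivSB q_b` on `N_Δ`)

Cell `hodgecm-mathlib`, crux item hLiu418 = `stmt-HodgeConjecture-24832`, route of record `HCCMUnconditional`; squad K2 ∕ K2Liu, prover K2Liu-p01 (g6).
THEOREMS ONLY (no `def`, no instance, no notation, no named fact, no `sorry`); lane `--supports stmt-HodgeConjecture-24832 --as helper`.

File 1 (★ `K2LiuDeltaSpTransportSiegelLetters`) identified, for the GR91 local doubled datum, `deltaCoords ∘ ι(h) ∘ deltaCoords⁻¹ = leviSp a d · unipotentSp b` for `h ∈ P_Δ`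
(`IsSiegelDelta h`) and `= unipotentSp b` for adapted Siegel unipotents.  Here, by implementer uniqueness (★ A2c `K2LiuKudlaRallisMapDeltaModel`,
★ `implementerUniqueUpToScalar_localSchrodingerDelta`):
* §1 (any Schrödinger model with unique implementers) **`exists_toRep_eq_smul_levi_unipotent`** — a pair over `m(a,d) · n(b)` acts by
  `c • (leviEquivSB a ∘ unipotentEquivSB (½β(·, b·)))` (★ `levi_mem_MpPsi` · ★ `unipotent_mem_MpPsi`).
* §2 (β-1's names; `s` any CM-model splitting over `ι` — ★ `proj_localSplitting` —, `sΔ := mpTransportLoc Γ ∘ s`): `proj_transport_eq`;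
  **`exists_proj_transport_eq_leviSp_mul_unipotentSp`** (`h ∈ P_Δ`), **`exists_proj_transport_eq_unipotentSp`** (adapted `u ∈ N_Δ`);
  **`exists_toRep_transport_eq_smul_levi_unipotent`**, **`exists_toRep_transport_eq_smul_unipotent`** — the `M_Δ N_Δ` ∕ `N_Δ` inputs of ★ A2a
  (`krFun_leviOp`, `krFun_unipotentOp`, via ★ A2c `exists_krFun_toRep_levi`∕`_unipotent`) in the doubling-polarised model.
NOT here (A2d-2): the explicit Levi blocks (master formula in the adapted blocks of ★ `DoubledUnitaryAdaptedBlocks`), the `1 ⊗ g` letter, the Weyl letter.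

HONEST LABEL: HC_CM is proved only modulo the printed citations (2 remaining named inputs: hLiu418 = stmt-HodgeConjecture-24832, h413 = stmt-HodgeConjecture-24833)
until rung 0 closes; helper, closes no item.
References: [Weil1964] n° 6, n° 13; [Kudla1994] §3 Thm. 3.1; [MoeglinVignerasWaldspurger1987] Chap. 2 II.1 (A)(B), II.6; [HarrisKudlaSweet1996] §1 (1.11)–(1.15).
-/

set_option autoImplicit false
set_option linter.dupNamespace false -- the mandated namespace repeats `HodgeConjecture.HodgeConjecture`

noncomputable section

open Matrix Topology
open scoped NNReal
open NumberField IsDedekindDomain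
open Literature.NumberTheory.Automorphic Literature.NumberTheory.Automorphic.UnitaryGroup
open Literature.RepresentationTheory.HeisenbergGroup
open Literature.NumberTheory.GelbartRogawski1991 Literature.NumberTheory.GelbartRogawski1991.AdaptedBlocks
open Literature.NumberTheory.GelbartRogawski1991.UnitaryDualPair.LocalSplitting
open Summit.HodgeConjecture.HodgeConjecture.Cruxes.HLiu418.K2LiuDeltaSpTransportSiegelLetters

namespace Summit.HodgeConjecture.HodgeConjecture.Cruxes.HLiu418.K2LiuDeltaSpTransportSiegelJunction

universe u

/-! ## §1 Pairs over `m(a,d) · n(b)` -/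

section Junction

variable {R : Type u} [CommRing R] [Invertible (2 : R)] {X : Type*} {Y : Type*} [AddCommGroup X] [Module R X]
  [AddCommGroup Y] [Module R Y] (β : X →ₗ[R] Y →ₗ[R] R) (ψ : AddChar R Circle)
  [TopologicalSpace X] [TopologicalSpace R] [IsTopologicalAddGroup X] [ContinuousNeg R]
  (hψ : IsLocallyConstant (⇑ψ : R → Circle)) (hβ : ∀ y : Y, Continuous fun u : X => β u y)

/-- **A PAIR OVER `m(a,d) · n(b)` ACTS BY `c • (leviEquivSB a ∘ unipotentEquivSB (½β(·, b·)))`** (implementer uniqueness; ★ `levi_mem_MpPsi` · ★ `unipotent_mem_MpPsi`).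
[cite: MoeglinVignerasWaldspurger1987, Chap. 2 II.1 (A), II.6] [cite: Weil1964, n° 13] -/
theorem exists_toRep_eq_smul_levi_unipotent (hU : ImplementerUniqueUpToScalar (schrodingerSB β ψ hψ hβ))
    (a : X ≃ₗ[R] X) (d : Y ≃ₗ[R] Y) (had : ∀ x y, β (a x) (d y) = β x y) (ha : Continuous a) (ha' : Continuous a.symm)
    (b : X →ₗ[R] Y) (hb : ∀ x x', β x (b x') = β x' (b x)) (hq : Continuous fun x : X => ⅟(2 : R) * β x (b x))
    (p : MpPsi (schrodingerSB β ψ hψ hβ)) (hp : MpPsi.proj (schrodingerSB β ψ hψ hβ) p = leviSp β a d had * unipotentSp β b hb) :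
    ∃ c : ℂˣ, ∀ f : SchwartzBruhat X,
      MpPsi.toRep (schrodingerSB β ψ hψ hβ) p f = (c : ℂ) • leviEquivSB a ha ha' (unipotentEquivSB ψ hψ (fun x => ⅟(2 : R) * β x (b x)) hq f) := by
  have hmem : (leviSp β a d had * unipotentSp β b hb, leviEquivSB a ha ha' * unipotentEquivSB ψ hψ (fun x => ⅟(2 : R) * β x (b x)) hq) ∈
      MpPsi (schrodingerSB β ψ hψ hβ) := by
    have h := (MpPsi (schrodingerSB β ψ hψ hβ)).mul_mem (levi_mem_MpPsi β ψ hψ hβ a d had ha ha') (unipotent_mem_MpPsi β ψ hψ hβ b hb hq)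
    exact h
  have hM : Implements (schrodingerSB β ψ hψ hβ) (ofSymplectic _ (leviSp β a d had * unipotentSp β b hb))
      (leviEquivSB a ha ha' * unipotentEquivSB ψ hψ (fun x => ⅟(2 : R) * β x (b x)) hq) := (mem_MpPsi _ _).1 hmem
  have hM' : Implements (schrodingerSB β ψ hψ hβ) (ofSymplectic _ (leviSp β a d had * unipotentSp β b hb)) (MpPsi.toOp (schrodingerSB β ψ hψ hβ) p) := by
    have h := MpPsi.toRep_implements (schrodingerSB β ψ hψ hβ) p
    rwa [← MpPsi.proj_apply, hp] at h
  obtain ⟨c, hc⟩ := hU _ _ _ hM hM'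
  exact ⟨c, fun f => hc f⟩

end Junction

/-! ## §2 In (β-1)'s names -/

section CM

open Literature.NumberTheory.GelbartRogawski1991.GRConstruction Literature.NumberTheory.GelbartRogawski1991.UnitaryDualPair
open Summit.HodgeConjecture.HodgeConjecture.Cruxes.HLiu418.K2LiuDoublingSchrodingerModelDefs
open Summit.HodgeConjecture.HodgeConjecture.Cruxes.HLiu418.K2LiuDoublingModelComparison
open Summit.HodgeConjecture.HodgeConjecture.Cruxes.HLiu418.K2LiuKudlaRallisMapDeltaModel

variable (L : Type) [Field L] [NumberField L] [IsCMField L]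
variable {N M n : ℕ} (e : Fin N × Fin M ≃ Fin n)
  (dV : Fin N → L) (hdV : ∀ i, IsCMField.complexConj L (dV i) = dV i) (hdV0 : ∀ i, dV i ≠ 0)
  (dW : Fin M → L) (hdW : ∀ i, IsCMField.complexConj L (dW i) = dW i) (hdW0 : ∀ i, dW i ≠ 0)
  (v : HeightOneSpectrum (𝓞 (Fp L)))

/-- **the transported splitting lies over the `ℓ_Δ`-adapted letter**: for a CM-model splitting `s` over `ι` (★ `proj_localSplitting`) and `sΔ = mpTransportLoc Γ ∘ s`,
`proj (sΔ h) = deltaCoords ∘ ι(h) ∘ deltaCoords⁻¹` (★ `proj_mpTransportLoc_comp`). [cite: MoeglinVignerasWaldspurger1987, Chap. 2 II.1 (B)] -/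
theorem proj_transport_eq (Γ : SchwartzBruhat (Fin (n + n) → v.adicCompletion (Fp L)) ≃ₗ[ℂ] SchwartzBruhat (Fin (n + n) → v.adicCompletion (Fp L)))
    (hΓ : IsDeltaIntertwiner L e dV hdV dW hdW v Γ)
    (s : UnitaryGroup.localPi L (IsCMField.complexConj L) (n + n) (hermD L e dV hdV dW hdW) v →* LocalMp (Fp L) (n + n) (gramD L e dV hdV dW hdW) v)
    (hs : ∀ h, MpPsi.proj _ (s h) = iotaD (Fp L) L (IsCMField.complexConj L) (complexConj_imagUnit L) (imagUnit_ne_zero L) (imagUnit_mul_self L) v n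
      (gramR_isSymm L e dV hdV dW hdW) (hermD_eq_map_gramD L e dV hdV dW hdW) h)
    (h : UnitaryGroup.localPi L (IsCMField.complexConj L) (n + n) (hermD L e dV hdV dW hdW) v) :
    MpPsi.proj (localSchrodingerDelta L e dV hdV dW hdW v) (((mpTransportLoc L e dV hdV dW hdW v Γ hΓ).toMonoidHom.comp s) h) =
      deltaSpTransportLoc L e dV hdV dW hdW v (iotaD (Fp L) L (IsCMField.complexConj L) (complexConj_imagUnit L) (imagUnit_ne_zero L) (imagUnit_mul_self L) v n
        (gramR_isSymm L e dV hdV dW hdW) (hermD_eq_map_gramD L e dV hdV dW hdW) h) := by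
  rw [proj_mpTransportLoc_comp, hs]

include hdV0 hdW0 in
/-- **THE `P_Δ` LETTER IN (β-1)'s NAMES, Sp-level**: for a CM-model splitting `s` over `ι` and `h ∈ P_Δ(L⁺_v)`, the symplectic part of `sΔ h` is
`leviSp a d · unipotentSp b` for the pairing of `deltaGramLoc v`. [cite: Kudla1994, §3] [cite: Weil1964, n° 6] -/
theorem exists_proj_transport_eq_leviSp_mul_unipotentSp
    (Γ : SchwartzBruhat (Fin (n + n) → v.adicCompletion (Fp L)) ≃ₗ[ℂ] SchwartzBruhat (Fin (n + n) → v.adicCompletion (Fp L)))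
    (hΓ : IsDeltaIntertwiner L e dV hdV dW hdW v Γ)
    (s : UnitaryGroup.localPi L (IsCMField.complexConj L) (n + n) (hermD L e dV hdV dW hdW) v →* LocalMp (Fp L) (n + n) (gramD L e dV hdV dW hdW) v)
    (hs : ∀ h, MpPsi.proj _ (s h) = iotaD (Fp L) L (IsCMField.complexConj L) (complexConj_imagUnit L) (imagUnit_ne_zero L) (imagUnit_mul_self L) v n
      (gramR_isSymm L e dV hdV dW hdW) (hermD_eq_map_gramD L e dV hdV dW hdW) h)
    (h : UnitaryGroup.localPi L (IsCMField.complexConj L) (n + n) (hermD L e dV hdV dW hdW) v)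
    (hh : IsSiegelDelta (Fp L) L (IsCMField.complexConj L) (complexConj_imagUnit L) (imagUnit_ne_zero L) (imagUnit_mul_self L) v n
      (gramR_isSymm L e dV hdV dW hdW) (hermD_eq_map_gramD L e dV hdV dW hdW) h) :
    ∃ (a d : (Fin (n + n) → v.adicCompletion (Fp L)) ≃ₗ[v.adicCompletion (Fp L)] (Fin (n + n) → v.adicCompletion (Fp L)))
      (had : ∀ x y : Fin (n + n) → v.adicCompletion (Fp L),
        Matrix.toLinearMap₂' (v.adicCompletion (Fp L)) (deltaGramLoc L e dV hdV dW hdW v) (a x) (d y) =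
          Matrix.toLinearMap₂' (v.adicCompletion (Fp L)) (deltaGramLoc L e dV hdV dW hdW v) x y)
      (b : (Fin (n + n) → v.adicCompletion (Fp L)) →ₗ[v.adicCompletion (Fp L)] (Fin (n + n) → v.adicCompletion (Fp L)))
      (hb : ∀ x x' : Fin (n + n) → v.adicCompletion (Fp L),
        Matrix.toLinearMap₂' (v.adicCompletion (Fp L)) (deltaGramLoc L e dV hdV dW hdW v) x (b x') =
          Matrix.toLinearMap₂' (v.adicCompletion (Fp L)) (deltaGramLoc L e dV hdV dW hdW v) x' (b x)),
      MpPsi.proj (localSchrodingerDelta L e dV hdV dW hdW v) (((mpTransportLoc L e dV hdV dW hdW v Γ hΓ).toMonoidHom.comp s) h) =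
        leviSp _ a d had * unipotentSp _ b hb := by
  have hx := exists_deltaTransport_iotaD_eq_leviSp_mul_unipotentSp (Fp L) L (IsCMField.complexConj L) (complexConj_imagUnit L)
    (imagUnit_ne_zero L) (imagUnit_mul_self L) v n (gramR_isSymm L e dV hdV dW hdW) (isUnit_det_gramR₀ L e dV hdV hdV0 dW hdW hdW0)
    (hermD_eq_map_gramD L e dV hdV dW hdW) h hh
  obtain ⟨a, d', had, b, hb, heq⟩ := hx
  refine ⟨a, d', had, b, hb, ?_⟩
  rw [proj_transport_eq L e dV hdV dW hdW v Γ hΓ s hs h]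
  exact heq

include hdV0 hdW0 in
/-- **THE `P_Δ` LETTER THROUGH THE WEIL OPERATORS (β-1 names)**: with `(a, d, b)` as in `exists_proj_transport_eq_leviSp_mul_unipotentSp` (or any Levi × unipotent
factorisation of `proj (sΔ h)`), `ω^Δ(sΔ h) = c • (leviEquivSB a ∘ unipotentEquivSB (½β_{J_Δ}(·, b·)))` for some `c ∈ ℂˣ` — the `M_Δ N_Δ` input of ★ A2a in (β-1)'s model.
[cite: Kudla1994, §3 Thm. 3.1] [cite: MoeglinVignerasWaldspurger1987, Chap. 2 II.1, II.6] -/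
theorem exists_toRep_transport_eq_smul_levi_unipotent
    (p : LocalMpDelta L e dV hdV dW hdW v)
    (a d : (Fin (n + n) → v.adicCompletion (Fp L)) ≃ₗ[v.adicCompletion (Fp L)] (Fin (n + n) → v.adicCompletion (Fp L)))
    (had : ∀ x y : Fin (n + n) → v.adicCompletion (Fp L),
      Matrix.toLinearMap₂' (v.adicCompletion (Fp L)) (deltaGramLoc L e dV hdV dW hdW v) (a x) (d y) =
        Matrix.toLinearMap₂' (v.adicCompletion (Fp L)) (deltaGramLoc L e dV hdV dW hdW v) x y)
    (ha : Continuous a) (ha' : Continuous a.symm)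
    (b : (Fin (n + n) → v.adicCompletion (Fp L)) →ₗ[v.adicCompletion (Fp L)] (Fin (n + n) → v.adicCompletion (Fp L)))
    (hb : ∀ x x' : Fin (n + n) → v.adicCompletion (Fp L),
      Matrix.toLinearMap₂' (v.adicCompletion (Fp L)) (deltaGramLoc L e dV hdV dW hdW v) x (b x') =
        Matrix.toLinearMap₂' (v.adicCompletion (Fp L)) (deltaGramLoc L e dV hdV dW hdW v) x' (b x))
    (hq : Continuous fun x : Fin (n + n) → v.adicCompletion (Fp L) =>
      ⅟(2 : v.adicCompletion (Fp L)) * Matrix.toLinearMap₂' (v.adicCompletion (Fp L)) (deltaGramLoc L e dV hdV dW hdW v) x (b x))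
    (hp : MpPsi.proj (localSchrodingerDelta L e dV hdV dW hdW v) p = leviSp _ a d had * unipotentSp _ b hb) :
    ∃ c : ℂˣ, ∀ f : SchwartzBruhat (Fin (n + n) → v.adicCompletion (Fp L)),
      MpPsi.toRep (localSchrodingerDelta L e dV hdV dW hdW v) p f =
        (c : ℂ) • leviEquivSB a ha ha' (unipotentEquivSB (adeleAddCharAt (Fp L) v)
          (isLocallyConstant_of_isContinuousNontrivial (isContinuousNontrivial_adeleAddCharAt (Fp L) v))
          (fun x => ⅟(2 : v.adicCompletion (Fp L)) * Matrix.toLinearMap₂' (v.adicCompletion (Fp L)) (deltaGramLoc L e dV hdV dW hdW v) x (b x)) hq f) :=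
  exists_toRep_eq_smul_levi_unipotent (Matrix.toLinearMap₂' (v.adicCompletion (Fp L)) (deltaGramLoc L e dV hdV dW hdW v))
    (adeleAddCharAt (Fp L) v) (isLocallyConstant_of_isContinuousNontrivial (isContinuousNontrivial_adeleAddCharAt (Fp L) v))
    (K2LiuDoublingSchrodingerModelDefs.continuous_toLinearMap₂'_left L (deltaGramLoc L e dV hdV dW hdW v))
    (K2LiuKudlaRallisMapDeltaModel.implementerUniqueUpToScalar_localSchrodingerDelta L e dV hdV hdV0 dW hdW hdW0 v) a d had ha ha' b hb hq p hp

include hdV0 hdW0 in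
/-- **THE `N_Δ` LETTER IN (β-1)'s NAMES, Sp-level**: an adapted Siegel unipotent `u` (`adapt (matA u) = (1, t; 0, 1)`) has `proj (sΔ u) = unipotentSp b`.
[cite: Kudla1994, §3 Thm. 3.1] [cite: Weil1964, n° 6] -/
theorem exists_proj_transport_eq_unipotentSp
    (Γ : SchwartzBruhat (Fin (n + n) → v.adicCompletion (Fp L)) ≃ₗ[ℂ] SchwartzBruhat (Fin (n + n) → v.adicCompletion (Fp L)))
    (hΓ : IsDeltaIntertwiner L e dV hdV dW hdW v Γ)
    (s : UnitaryGroup.localPi L (IsCMField.complexConj L) (n + n) (hermD L e dV hdV dW hdW) v →* LocalMp (Fp L) (n + n) (gramD L e dV hdV dW hdW) v)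
    (hs : ∀ h, MpPsi.proj _ (s h) = iotaD (Fp L) L (IsCMField.complexConj L) (complexConj_imagUnit L) (imagUnit_ne_zero L) (imagUnit_mul_self L) v n
      (gramR_isSymm L e dV hdV dW hdW) (hermD_eq_map_gramD L e dV hdV dW hdW) h)
    (u : UnitaryGroup.localPi L (IsCMField.complexConj L) (n + n) (hermD L e dV hdV dW hdW) v) (t : Matrix (Fin n) (Fin n) (LocalRing L v))
    (hu : adapt (matA (Fp L) L (IsCMField.complexConj L) v n u) = Matrix.fromBlocks 1 t 0 1) :
    ∃ (b : (Fin (n + n) → v.adicCompletion (Fp L)) →ₗ[v.adicCompletion (Fp L)] (Fin (n + n) → v.adicCompletion (Fp L)))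
      (hb : ∀ x x' : Fin (n + n) → v.adicCompletion (Fp L),
        Matrix.toLinearMap₂' (v.adicCompletion (Fp L)) (deltaGramLoc L e dV hdV dW hdW v) x (b x') =
          Matrix.toLinearMap₂' (v.adicCompletion (Fp L)) (deltaGramLoc L e dV hdV dW hdW v) x' (b x)),
      MpPsi.proj (localSchrodingerDelta L e dV hdV dW hdW v) (((mpTransportLoc L e dV hdV dW hdW v Γ hΓ).toMonoidHom.comp s) u) = unipotentSp _ b hb := by
  have hx := exists_deltaTransport_iotaD_eq_unipotentSp (Fp L) L (IsCMField.complexConj L) (complexConj_imagUnit L)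
    (imagUnit_ne_zero L) (imagUnit_mul_self L) v n (gramR_isSymm L e dV hdV dW hdW) (isUnit_det_gramR₀ L e dV hdV hdV0 dW hdW hdW0)
    (hermD_eq_map_gramD L e dV hdV dW hdW) u t hu
  obtain ⟨b, hb, heq⟩ := hx
  refine ⟨b, hb, ?_⟩
  rw [proj_transport_eq L e dV hdV dW hdW v Γ hΓ s hs u]
  exact heq

include hdV0 hdW0 in
/-- **THE `N_Δ` LETTER THROUGH THE WEIL OPERATORS (β-1 names)**: a pair of the doubling-polarised model over `unipotentSp b` acts by
`c • unipotentEquivSB (½β_{J_Δ}(·, b·))` — `N_Δ` acts on `𝒮(X_Δ)` by second-degree characters up to the splitting scalar (★ A2a `krFun_unipotentOp` input).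
[cite: Kudla1994, §3 Thm. 3.1] [cite: MoeglinVignerasWaldspurger1987, Chap. 2 II.6] -/
theorem exists_toRep_transport_eq_smul_unipotent
    (p : LocalMpDelta L e dV hdV dW hdW v)
    (b : (Fin (n + n) → v.adicCompletion (Fp L)) →ₗ[v.adicCompletion (Fp L)] (Fin (n + n) → v.adicCompletion (Fp L)))
    (hb : ∀ x x' : Fin (n + n) → v.adicCompletion (Fp L),
      Matrix.toLinearMap₂' (v.adicCompletion (Fp L)) (deltaGramLoc L e dV hdV dW hdW v) x (b x') =
        Matrix.toLinearMap₂' (v.adicCompletion (Fp L)) (deltaGramLoc L e dV hdV dW hdW v) x' (b x))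
    (hq : Continuous fun x : Fin (n + n) → v.adicCompletion (Fp L) =>
      ⅟(2 : v.adicCompletion (Fp L)) * Matrix.toLinearMap₂' (v.adicCompletion (Fp L)) (deltaGramLoc L e dV hdV dW hdW v) x (b x))
    (hp : MpPsi.proj (localSchrodingerDelta L e dV hdV dW hdW v) p = unipotentSp _ b hb) :
    ∃ c : ℂˣ, ∀ f : SchwartzBruhat (Fin (n + n) → v.adicCompletion (Fp L)),
      MpPsi.toRep (localSchrodingerDelta L e dV hdV dW hdW v) p f =
        (c : ℂ) • unipotentEquivSB (adeleAddCharAt (Fp L) v) (isLocallyConstant_of_isContinuousNontrivial (isContinuousNontrivial_adeleAddCharAt (Fp L) v))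
          (fun x => ⅟(2 : v.adicCompletion (Fp L)) * Matrix.toLinearMap₂' (v.adicCompletion (Fp L)) (deltaGramLoc L e dV hdV dW hdW v) x (b x)) hq f :=
  K2LiuKudlaRallisMapDeltaModel.exists_toRep_eq_smul_unipotentEquivSB (Matrix.toLinearMap₂' (v.adicCompletion (Fp L)) (deltaGramLoc L e dV hdV dW hdW v))
    (adeleAddCharAt (Fp L) v) (isLocallyConstant_of_isContinuousNontrivial (isContinuousNontrivial_adeleAddCharAt (Fp L) v))
    (K2LiuDoublingSchrodingerModelDefs.continuous_toLinearMap₂'_left L (deltaGramLoc L e dV hdV dW hdW v))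
    (K2LiuKudlaRallisMapDeltaModel.implementerUniqueUpToScalar_localSchrodingerDelta L e dV hdV hdV0 dW hdW hdW0 v) b hb hq p hp

end CM
end Summit.HodgeConjecture.HodgeConjecture.Cruxes.HLiu418.K2LiuDeltaSpTransportSiegelJunction

end
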